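import Literature.MathematicalPhysics.KineticTheory.DiPernaLionsLossConvolution
import HarnessLib

/-!
# Weak compactness of the collision terms of the approximating sequence (CIP Lemma 5.3.7) — proofs

Topic: MathematicalPhysics / KineticTheory. Discharge of the named fact
`diPernaLions_approx_collisionTerms_weaklyCompact` (`DiPernaLionsCollisionTerms.lean`): for the
DiPerna–Lions approximating sequence, the normalised renormalised collision terms
`aₙ Q±ₙ(fⁿ,fⁿ)/(1+fⁿ)` are equi-integrable and uniformly tight on every restricted slab
`(0,T) × ℝ^d × B̄_R` (CIP 1994 §5.3 Lemma 5.3.7). With `DiPernaLionsEquicontinuityProofs` and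
`DiPernaLionsExtractionProofs` this closes the extraction step `diPernaLions_extraction` of the
weak-stability half of `diperna_lions`. Everything is proved; the file declares theorems only.

* Loss half: `‖aₙ Q⁻ₙ/(1+fⁿ)‖ₑ ≤ Aₙ ∗ fⁿ` (`DiPernaLionsLossConvolution`), and the convolutions are
  handled by `exists_conv_dominated_split` (bounded near part `≤ M ᾱ_K`, height tail through the
  equi-integrability of `(fⁿ)` on slabs, far part through the growth condition (3.12)),
  `exists_conv_dominated_off_ball` (tightness in `x` through second moments) and
  `exists_conv_lintegral_le`; the generic lemmas of `UnifIntegrableDomination` turn these into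
  `UniformIntegrable`/`UnifTight`.
* Gain half: `arkeryd_inequality` (`p' ≤ K p + (log K)⁻¹ (p'-p) log (p'/p)`, CIP (3.27)) gives
  `IsDiPernaLionsApproximateSolution.enorm_gain_term_le`:
  `‖aₙ Q⁺ₙ/(1+fⁿ)‖ₑ ≤ K ‖aₙ Q⁻ₙ/(1+fⁿ)‖ₑ + (log K)⁻¹ D̂ₙ` with the dissipation majorant
  `D̂ₙ = aₙ ∫⁻ ofReal (Bₙ Γ)`, whose slab integral is `≤ 4 ∫ ẽₙ ≤ 4 C` by
  `lintegral_dissipation_majorant_eq`, `lintegral_slab_dissipation_majorant_le` and (3.23)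
  (`UniformDiPernaLionsBounds.dissipation_le`).
* `diPernaLions_approx_collisionTerms_weaklyCompact_holds`: the assembly.

## References

* C. Cercignani, R. Illner, M. Pulvirenti, *The Mathematical Theory of Dilute Gases*, Springer
  (1994), §5.3 Lemma 5.3.7 (p. 148) and its proof (pp. 148–150); (3.27) and its proof (p. 160).
* R. J. DiPerna, P.-L. Lions, Ann. of Math. 130 (1989), §III–IV.
* L. Arkeryd, Arch. Rational Mech. Anal. 45 (1972) (the inequality (3.27)).
-/

open MeasureTheory Metric Real Set Filter Topology
open scoped InnerProductSpace ENNReal NNReal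

noncomputable section

namespace Literature.MathematicalPhysics.KineticTheory

open Literature.Analysis.FluidPDE Literature.Analysis.FunctionSpaces

variable {E : Type*} [NormedAddCommGroup E] [InnerProductSpace ℝ E] [FiniteDimensional ℝ E]
  [MeasurableSpace E] [BorelSpace E]

/-! ## Arkeryd's inequality -/

section Arkeryd

/-- **Arkeryd's inequality** (CIP 1994 §5.3 (3.27) and its proof p. 160; DiPerna–Lions 1989 §III):
for `p, p' > 0` and `K > 1`, `p' ≤ K p + (log K)⁻¹ (p' - p) log (p'/p)` — either `p' ≤ K p`, or
`log (p'/p) ≥ log K` and `p' - p ≤ (log K)⁻¹ (p' - p) log (p'/p)`. [cite: CIPDiluteGases1994, §5.3 (3.27)] -/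
theorem arkeryd_inequality {p p' K : ℝ} (hp : 0 < p) (hp' : 0 < p') (hK : 1 < K) :
    p' ≤ K * p + (Real.log K)⁻¹ * ((p' - p) * Real.log (p' / p)) := by
  have hlogK : 0 < Real.log K := Real.log_pos hK
  have hΓ : 0 ≤ (p' - p) * Real.log (p' / p) := by
    rcases le_total p p' with h | h
    · exact mul_nonneg (sub_nonneg.2 h) (Real.log_nonneg ((one_le_div hp).2 h))
    · exact mul_nonneg_of_nonpos_of_nonpos (sub_nonpos.2 h)
        (Real.log_nonpos (div_pos hp' hp).le ((div_le_one hp).2 h))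
  rcases le_or_gt p' (K * p) with h1 | h1
  · linarith [mul_nonneg (inv_nonneg.2 hlogK.le) hΓ]
  · -- `p' > K p`: `log (p'/p) ≥ log K`
    have hKp : K ≤ p' / p := by rw [le_div_iff₀ hp]; linarith
    have hlog : Real.log K ≤ Real.log (p' / p) := Real.log_le_log (by linarith) hKp
    have hpp : 0 ≤ p' - p := by nlinarith
    have h2 : (p' - p) * Real.log K ≤ (p' - p) * Real.log (p' / p) :=
      mul_le_mul_of_nonneg_left hlog hpp
    have h3 : p' - p ≤ (Real.log K)⁻¹ * ((p' - p) * Real.log (p' / p)) := by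
      rw [le_inv_mul_iff₀ hlogK]; linarith
    nlinarith

end Arkeryd

/-! ## The loss and gain terms against lower Lebesgue integrals -/

section GainLoss

variable {B : E × E → sphere (0 : E) 1 → ℝ}

/-- `ofReal Q⁻_B(g,g)(v) = ∫⁻∫⁻ ofReal (B g(v) g(w))` for a bounded nonnegative measurable kernel
and a nonnegative bounded integrable density. [folklore] -/
theorem ofReal_lossWith_eq_lintegral (hBm : Measurable (Function.uncurry B)) (hB0 : ∀ p ω, 0 ≤ B p ω)
    {Cb : ℝ} (hCb : ∀ p ω, B p ω ≤ Cb) {g : E → ℝ} (hgm : Measurable g) (hg0 : ∀ w, 0 ≤ g w)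
    (hgi : Integrable g) (v : E) :
    ENNReal.ofReal (lossWith B g g v) =
      ∫⁻ w, ∫⁻ ω, ENNReal.ofReal (B (v, w) ω * (g v * g w)) ∂(sphereMeasure : Measure (sphere (0 : E) 1)) := by
  haveI := isFiniteMeasure_sphereMeasure (E := E)
  set S : ℝ := (sphereMeasure (E := E)).real univ with hS
  have hCb0 : ∀ p ω, (0 : ℝ) ≤ Cb := fun p ω => (hB0 p ω).trans (hCb p ω)
  -- the inner integrals
  set h : E → ℝ := fun w => ∫ ω, B (v, w) ω * (g v * g w) ∂(sphereMeasure : Measure (sphere (0 : E) 1))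
    with hh
  have hBvm : ∀ w, Measurable fun ω : sphere (0 : E) 1 => B (v, w) ω := fun w =>
    hBm.comp (measurable_const.prodMk measurable_id)
  have hinner_int : ∀ w, Integrable (fun ω : sphere (0 : E) 1 => B (v, w) ω * (g v * g w))
      (sphereMeasure : Measure (sphere (0 : E) 1)) := fun w => by
    refine (integrable_const (Cb * (g v * g w))).mono' ((hBvm w).mul_const _).aestronglyMeasurable
      (Eventually.of_forall fun ω => ?_)
    rw [Real.norm_eq_abs, abs_of_nonneg (mul_nonneg (hB0 _ _) (mul_nonneg (hg0 _) (hg0 _)))]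
    exact mul_le_mul_of_nonneg_right (hCb _ _) (mul_nonneg (hg0 _) (hg0 _))
  have hh0 : ∀ w, 0 ≤ h w := fun w => integral_nonneg fun ω =>
    mul_nonneg (hB0 _ _) (mul_nonneg (hg0 _) (hg0 _))
  have hhle : ∀ w, h w ≤ Cb * S * g v * g w := by
    intro w
    calc h w ≤ ∫ _ω, Cb * (g v * g w) ∂(sphereMeasure : Measure (sphere (0 : E) 1)) :=
          integral_mono_of_nonneg (Eventually.of_forall fun ω =>
            mul_nonneg (hB0 _ _) (mul_nonneg (hg0 _) (hg0 _))) (integrable_const _)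
            (Eventually.of_forall fun ω => mul_le_mul_of_nonneg_right (hCb _ _)
              (mul_nonneg (hg0 _) (hg0 _)))
      _ = Cb * S * g v * g w := by rw [integral_const, smul_eq_mul, hS]; ring
  have hhm : Measurable h := by
    have hk : Measurable fun q : E × sphere (0 : E) 1 => B (v, q.1) q.2 * (g v * g q.1) :=
      (hBm.comp ((measurable_const.prodMk measurable_fst).prodMk measurable_snd)).mul
        (measurable_const.mul (hgm.comp measurable_fst))
    exact (hk.stronglyMeasurable.integral_prod_right'
      (ν := (sphereMeasure : Measure (sphere (0 : E) 1)))).measurable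
  have hhi : Integrable h := by
    refine ((hgi.const_mul (Cb * S * g v))).mono' hhm.aestronglyMeasurable
      (Eventually.of_forall fun w => ?_)
    rw [Real.norm_eq_abs, abs_of_nonneg (hh0 w)]
    exact (hhle w).trans_eq (by ring)
  unfold lossWith
  rw [ofReal_integral_eq_lintegral_ofReal hhi (Eventually.of_forall hh0)]
  refine lintegral_congr fun w => ?_
  exact ofReal_integral_eq_lintegral_ofReal (hinner_int w) (Eventually.of_forall fun ω =>
    mul_nonneg (hB0 _ _) (mul_nonneg (hg0 _) (hg0 _)))

/-- `ofReal Q⁺_B(g,g)(v) ≤ ∫⁻∫⁻ ofReal (B g(v') g(w'))` for `B, g ≥ 0` (no integrability needed).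
[folklore] -/
theorem ofReal_gainWith_le_lintegral (hB0 : ∀ p ω, 0 ≤ B p ω) {g : E → ℝ} (hg0 : ∀ w, 0 ≤ g w)
    (v : E) :
    ENNReal.ofReal (gainWith B g g v) ≤
      ∫⁻ w, ∫⁻ ω, ENNReal.ofReal (B (v, w) ω * (g (collide ω (v, w)).1 * g (collide ω (v, w)).2))
        ∂(sphereMeasure : Measure (sphere (0 : E) 1)) := by
  have hnn : ∀ w ω, 0 ≤ B (v, w) ω * (g (collide ω (v, w)).1 * g (collide ω (v, w)).2) :=
    fun w ω => mul_nonneg (hB0 _ _) (mul_nonneg (hg0 _) (hg0 _))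
  have hk0 : ∀ w, 0 ≤ ∫ ω, B (v, w) ω * (g (collide ω (v, w)).1 * g (collide ω (v, w)).2)
      ∂(sphereMeasure : Measure (sphere (0 : E) 1)) := fun w => integral_nonneg (hnn w)
  unfold gainWith
  rw [← Real.enorm_eq_ofReal (integral_nonneg hk0)]
  refine (enorm_integral_le_lintegral_enorm _).trans (lintegral_mono fun w => ?_)
  rw [Real.enorm_eq_ofReal (hk0 w), ← Real.enorm_eq_ofReal (hk0 w)]
  refine (enorm_integral_le_lintegral_enorm _).trans (lintegral_mono fun ω => ?_)
  rw [Real.enorm_eq_ofReal (hnn w ω)]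

/-- **Pointwise domination of the gain term by the loss term and the entropy dissipation**
(CIP 1994 §5.3 Step 9 with (3.27): "`Q₊ⁿ ≤ K Q₋ⁿ + (ln K)⁻¹ eₙ`"): for an approximate solution,
a bounded DiPerna–Lions kernel, `K > 1` and `t > 0`,
`‖a Q⁺/(1+f)‖ₑ ≤ K ‖a Q⁻/(1+f)‖ₑ + (log K)⁻¹ · a ∫⁻ ofReal (B Γ) dw dω` with
`Γ = (f'f_*' - f f_*) log (f'f_*'/(f f_*))` the entropy-production integrand and
`a = (1 + δ ∫ f)⁻¹`. [cite: CIPDiluteGases1994, §5.3 Lemma 5.3.7 and (3.27) (pp. 150, 160)] -/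
theorem IsDiPernaLionsApproximateSolution.enorm_gain_term_le {δ : ℝ} {f : ℝ → E → E → ℝ}
    (hf : IsDiPernaLionsApproximateSolution δ B f) (hδ : 0 ≤ δ)
    (hBk : KineticTheory.IsDiPernaLionsKernel B) {Cb : ℝ} (hCb : ∀ p ω, B p ω ≤ Cb) {K : ℝ}
    (hK : 1 < K) (z : ℝ × E × E) (hz : 0 < z.1) :
    ‖(1 + δ * ∫ w, |f z.1 z.2.1 w|)⁻¹ * gainWith B (f z.1 z.2.1) (f z.1 z.2.1) z.2.2 /
        (1 + f z.1 z.2.1 z.2.2)‖ₑ ≤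
      ENNReal.ofReal K * ‖(1 + δ * ∫ w, |f z.1 z.2.1 w|)⁻¹ *
          lossWith B (f z.1 z.2.1) (f z.1 z.2.1) z.2.2 / (1 + f z.1 z.2.1 z.2.2)‖ₑ +
        ENNReal.ofReal (Real.log K)⁻¹ * (ENNReal.ofReal (1 + δ * ∫ w, |f z.1 z.2.1 w|)⁻¹ *
          ∫⁻ q, ENNReal.ofReal (entropyProductionIntegrand B (f z.1 z.2.1) ((z.2.2, q.1), q.2))
            ∂((volume : Measure E).prod sphereMeasure)) := by
  haveI := isFiniteMeasure_sphereMeasure (E := E)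
  obtain ⟨t, x, v⟩ := z
  simp only at hz ⊢
  set g : E → ℝ := f t x with hg
  set a : ℝ := (1 + δ * ∫ w, |g w|)⁻¹ with ha
  have hgpos : ∀ w, 0 < g w := fun w => hf.pos t hz.le x w
  have hg0 : ∀ w, 0 ≤ g w := fun w => (hgpos w).le
  obtain ⟨ha0, ha1⟩ := normalisingFactor_pos_and_le_one hδ g
  obtain ⟨hgc, ⟨Kg, hKg⟩, hgi⟩ := hf.slice_velocity hz.le x
  have hgm : Measurable g := hgc.measurable
  have hB0 := hBk.nonneg
  have hBm := hBk.measurable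
  set ν : Measure (E × sphere (0 : E) 1) := (volume : Measure E).prod sphereMeasure with hν
  -- the three integrands on `E × S`
  set P' : E × sphere (0 : E) 1 → ℝ := fun q =>
    B (v, q.1) q.2 * (g (collide q.2 (v, q.1)).1 * g (collide q.2 (v, q.1)).2) with hP'
  set P : E × sphere (0 : E) 1 → ℝ := fun q => B (v, q.1) q.2 * (g v * g q.1) with hP
  set Γ : E × sphere (0 : E) 1 → ℝ := fun q => entropyProductionIntegrand B g ((v, q.1), q.2) with hΓ
  have hPm : Measurable fun q => ENNReal.ofReal (P q) := by
    refine Measurable.ennreal_ofReal ?_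
    exact (hBm.comp ((measurable_const.prodMk measurable_fst).prodMk measurable_snd)).mul
      (measurable_const.mul (hgm.comp measurable_fst))
  have hΓ0 : ∀ q, 0 ≤ Γ q := fun q => entropyProductionIntegrand_nonneg hB0 hgpos _
  -- Arkeryd pointwise: `ofReal P' ≤ ofReal K * ofReal P + ofReal c * ofReal Γ`
  have hpt : ∀ q, ENNReal.ofReal (P' q) ≤ ENNReal.ofReal K * ENNReal.ofReal (P q) +
      ENNReal.ofReal (Real.log K)⁻¹ * ENNReal.ofReal (Γ q) := by
    intro q
    have hark := arkeryd_inequality (mul_pos (hgpos v) (hgpos q.1))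
      (mul_pos (hgpos (collide q.2 (v, q.1)).1) (hgpos (collide q.2 (v, q.1)).2)) hK
    have hmul := mul_le_mul_of_nonneg_left hark (hB0 (v, q.1) q.2)
    have hK0 : 0 ≤ K := by linarith
    have hc0 : 0 ≤ (Real.log K)⁻¹ := inv_nonneg.2 (Real.log_nonneg hK.le)
    rw [← ENNReal.ofReal_mul hK0, ← ENNReal.ofReal_mul hc0,
      ← ENNReal.ofReal_add (by rw [hP]; exact mul_nonneg hK0 (mul_nonneg (hB0 _ _)
        (mul_nonneg (hg0 _) (hg0 _)))) (mul_nonneg hc0 (hΓ0 q))]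
    refine ENNReal.ofReal_le_ofReal ?_
    simp only [hP', hP, hΓ, entropyProductionIntegrand] at hmul ⊢
    linarith
  -- the gain term against the product integral of `P'`
  have hgain : ENNReal.ofReal (gainWith B g g v) ≤ ∫⁻ q, ENNReal.ofReal (P' q) ∂ν := by
    have hP'm : Measurable fun q => ENNReal.ofReal (P' q) := by
      refine Measurable.ennreal_ofReal ?_
      have hc : Measurable fun q : E × sphere (0 : E) 1 => collide q.2 (v, q.1) :=
        continuous_collide_uncurry.measurable.comp ((measurable_const.prodMk measurable_fst).prodMk measurable_snd)
      exact (hBm.comp ((measurable_const.prodMk measurable_fst).prodMk measurable_snd)).mul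
        ((hgm.comp (measurable_fst.comp hc)).mul (hgm.comp (measurable_snd.comp hc)))
    rw [hν, lintegral_prod _ hP'm.aemeasurable]
    exact ofReal_gainWith_le_lintegral hB0 hg0 v
  have hloss : ∫⁻ q, ENNReal.ofReal (P q) ∂ν = ENNReal.ofReal (lossWith B g g v) := by
    rw [hν, lintegral_prod _ hPm.aemeasurable]
    exact (ofReal_lossWith_eq_lintegral hBm hB0 hCb hgm hg0 hgi v).symm
  -- normalisation factors
  have hgv : 0 < 1 + g v := by linarith [hg0 v]
  have hfac0 : 0 ≤ a / (1 + g v) := div_nonneg ha0.le hgv.le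
  have hfac_le : a / (1 + g v) ≤ a := div_le_self ha0.le (by linarith [hg0 v])
  have hgain0 : 0 ≤ gainWith B g g v := gainWith_nonneg hB0 hg0 v
  have hloss0 : 0 ≤ lossWith B g g v :=
    integral_nonneg fun w => integral_nonneg fun ω => mul_nonneg (hB0 _ _) (mul_nonneg (hg0 _) (hg0 _))
  -- rewrite both renormalised terms as `ofReal (a/(1+g v)) * ofReal Q±`
  have hL : ‖a * lossWith B g g v / (1 + g v)‖ₑ =
      ENNReal.ofReal (a / (1 + g v)) * ENNReal.ofReal (lossWith B g g v) := by
    rw [Real.enorm_eq_ofReal (div_nonneg (mul_nonneg ha0.le hloss0) hgv.le), ← ENNReal.ofReal_mul hfac0]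
    congr 1; rw [mul_div_right_comm]
  have hG : ‖a * gainWith B g g v / (1 + g v)‖ₑ =
      ENNReal.ofReal (a / (1 + g v)) * ENNReal.ofReal (gainWith B g g v) := by
    rw [Real.enorm_eq_ofReal (div_nonneg (mul_nonneg ha0.le hgain0) hgv.le), ← ENNReal.ofReal_mul hfac0]
    congr 1; rw [mul_div_right_comm]
  rw [hG, hL]
  calc ENNReal.ofReal (a / (1 + g v)) * ENNReal.ofReal (gainWith B g g v)
      ≤ ENNReal.ofReal (a / (1 + g v)) * ∫⁻ q, ENNReal.ofReal (P' q) ∂ν :=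
        mul_le_mul_of_nonneg_left hgain bot_le
    _ ≤ ENNReal.ofReal (a / (1 + g v)) * ∫⁻ q, (ENNReal.ofReal K * ENNReal.ofReal (P q) +
          ENNReal.ofReal (Real.log K)⁻¹ * ENNReal.ofReal (Γ q)) ∂ν :=
        mul_le_mul_of_nonneg_left (lintegral_mono hpt) bot_le
    _ = ENNReal.ofReal (a / (1 + g v)) * (ENNReal.ofReal K * ENNReal.ofReal (lossWith B g g v) +
          ENNReal.ofReal (Real.log K)⁻¹ * ∫⁻ q, ENNReal.ofReal (Γ q) ∂ν) := by
        rw [lintegral_add_left (hPm.const_mul _), lintegral_const_mul _ hPm,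
          lintegral_const_mul' _ _ ENNReal.ofReal_ne_top, hloss]
    _ = ENNReal.ofReal K * (ENNReal.ofReal (a / (1 + g v)) * ENNReal.ofReal (lossWith B g g v)) +
          ENNReal.ofReal (Real.log K)⁻¹ * (ENNReal.ofReal (a / (1 + g v)) * ∫⁻ q, ENNReal.ofReal (Γ q) ∂ν) := by
        rw [mul_add, mul_left_comm, mul_left_comm (ENNReal.ofReal (a / (1 + g v)))]
    _ ≤ ENNReal.ofReal K * (ENNReal.ofReal (a / (1 + g v)) * ENNReal.ofReal (lossWith B g g v)) +
          ENNReal.ofReal (Real.log K)⁻¹ * (ENNReal.ofReal a * ∫⁻ q, ENNReal.ofReal (Γ q) ∂ν) := by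
        gcongr

end GainLoss

/-! ## The dissipation majorant and its slab integral -/

section Dissipation

variable {B : E × E → sphere (0 : E) 1 → ℝ}

/-- Joint measurability of the entropy-production integrand with a measurably varying density.
[folklore] -/
theorem measurable_entropyProductionIntegrand_param {α : Type*} [MeasurableSpace α]
    (hBm : Measurable (Function.uncurry B)) {g : α → E → ℝ} (hg : Measurable (Function.uncurry g)) :
    Measurable fun p : α × ((E × E) × sphere (0 : E) 1) => entropyProductionIntegrand B (g p.1) p.2 := by
  unfold entropyProductionIntegrand
  have hB : Measurable fun p : α × ((E × E) × sphere (0 : E) 1) => B p.2.1 p.2.2 := hBm.comp measurable_snd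
  have hcol : Measurable fun p : α × ((E × E) × sphere (0 : E) 1) => collide p.2.2 p.2.1 :=
    continuous_collide_uncurry.measurable.comp measurable_snd
  have hga : ∀ {u : α × ((E × E) × sphere (0 : E) 1) → E}, Measurable u →
      Measurable fun p : α × ((E × E) × sphere (0 : E) 1) => g p.1 (u p) :=
    fun hu => hg.comp (measurable_fst.prodMk hu)
  have hc1 := hga (measurable_fst.comp hcol)
  have hc2 := hga (measurable_snd.comp hcol)
  have h1 := hga measurable_snd.fst.fst
  have h2 := hga measurable_snd.fst.snd
  exact hB.mul (((hc1.mul hc2).sub (h1.mul h2)).mul (measurable_log.comp ((hc1.mul hc2).div (h1.mul h2))))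

/-- The velocity integral of the dissipation majorant is four times the normalised entropy
production: `∫⁻_v (ofReal a ∫⁻_{(w,ω)} ofReal (B Γ)) = 4 ẽ_δ(g)`. [folklore] -/
theorem lintegral_dissipation_majorant_eq (hBm : Measurable (Function.uncurry B)) {g : E → ℝ}
    (hgm : Measurable g) (δ : ℝ) :
    ∫⁻ v, ENNReal.ofReal (1 + δ * ∫ w, |g w|)⁻¹ *
        ∫⁻ q, ENNReal.ofReal (entropyProductionIntegrand B g ((v, q.1), q.2))
          ∂((volume : Measure E).prod sphereMeasure) =
      4 * eTruncatedEntropyProduction δ B g := by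
  haveI := isFiniteMeasure_sphereMeasure (E := E)
  have hepi : Measurable fun r : (E × E) × sphere (0 : E) 1 =>
      ENNReal.ofReal (entropyProductionIntegrand B g r) := by
    have h := measurable_entropyProductionIntegrand_param (α := Unit) hBm (g := fun _ => g)
      (hgm.comp measurable_snd)
    exact (h.comp ((measurable_const (a := ())).prodMk measurable_id :
      Measurable fun r : (E × E) × sphere (0 : E) 1 => ((), r))).ennreal_ofReal
  -- reassociate `E × (E × S)` and `(E × E) × S`
  have hassoc : ∫⁻ v, ∫⁻ q, ENNReal.ofReal (entropyProductionIntegrand B g ((v, q.1), q.2))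
      ∂((volume : Measure E).prod sphereMeasure) =
      ∫⁻ r, ENNReal.ofReal (entropyProductionIntegrand B g r)
        ∂(((volume : Measure E).prod volume).prod sphereMeasure) := by
    have h1 : Measurable fun p : E × (E × sphere (0 : E) 1) =>
        ENNReal.ofReal (entropyProductionIntegrand B g ((p.1, p.2.1), p.2.2)) :=
      hepi.comp ((measurable_fst.prodMk measurable_snd.fst).prodMk measurable_snd.snd)
    rw [← lintegral_prod _ h1.aemeasurable,
      ← (measurePreserving_prodAssoc (volume : Measure E) (volume : Measure E)
        (sphereMeasure : Measure (sphere (0 : E) 1))).lintegral_comp_emb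
        (MeasurableEquiv.measurableEmbedding _)]
    rfl
  rw [lintegral_const_mul' _ _ ENNReal.ofReal_ne_top, hassoc, eTruncatedEntropyProduction,
    eEntropyProduction]
  have h4 : ∫⁻ r, ENNReal.ofReal (4⁻¹ * entropyProductionIntegrand B g r)
      ∂(((volume : Measure E).prod volume).prod sphereMeasure) =
      ENNReal.ofReal 4⁻¹ * ∫⁻ r, ENNReal.ofReal (entropyProductionIntegrand B g r)
        ∂(((volume : Measure E).prod volume).prod sphereMeasure) := by
    rw [← lintegral_const_mul' _ _ ENNReal.ofReal_ne_top]
    refine lintegral_congr fun r => ?_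
    rw [ENNReal.ofReal_mul (by norm_num)]
  rw [h4]
  have h44 : (4 : ℝ≥0∞) * ENNReal.ofReal 4⁻¹ = 1 := by
    rw [← ENNReal.ofReal_ofNat 4, ← ENNReal.ofReal_mul (by norm_num)]; norm_num
  calc ENNReal.ofReal (1 + δ * ∫ w, |g w|)⁻¹ *
        ∫⁻ r, ENNReal.ofReal (entropyProductionIntegrand B g r) ∂((volume.prod volume).prod sphereMeasure)
      = (4 * ENNReal.ofReal 4⁻¹) * (ENNReal.ofReal (1 + δ * ∫ w, |g w|)⁻¹ *
          ∫⁻ r, ENNReal.ofReal (entropyProductionIntegrand B g r) ∂((volume.prod volume).prod sphereMeasure)) := by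
        rw [h44, one_mul]
    _ = _ := by ring

/-- Lebesgue measure on `(0,T) × E` restricted, as a product. [folklore] -/
theorem volume_prod_restrict_Ioo_univ (T : ℝ) :
    ((volume : Measure ℝ).prod (volume : Measure E)).restrict (Ioo 0 T ×ˢ univ) =
      ((volume : Measure ℝ).restrict (Ioo 0 T)).prod (volume : Measure E) := by
  rw [← Measure.restrict_univ (μ := (volume : Measure E)), Measure.prod_restrict, Measure.restrict_univ]

/-- Measurability of the normalising factor along the time clamp. [folklore] -/
theorem IsDiPernaLionsApproximateSolution.measurable_normalisingFactor_clamp {δ : ℝ}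
    {f : ℝ → E → E → ℝ} (hf : IsDiPernaLionsApproximateSolution δ B f) (δ' : ℝ) :
    Measurable fun p : ℝ × E => (1 + δ' * ∫ w, |f (max p.1 0) p.2 w|)⁻¹ := by
  have hc : Continuous fun y : (ℝ × E) × E => |f (max y.1.1 0) y.1.2 y.2| :=
    continuous_abs.comp (hf.continuous_clamp (continuous_fst.comp continuous_fst)
      (continuous_snd.comp continuous_fst) continuous_snd)
  exact (measurable_const.add (measurable_const.mul
    (hc.stronglyMeasurable.integral_prod_right' (ν := (volume : Measure E))).measurable)).inv

/-- Measurability of the normalised entropy production of the slices along the time clamp.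
[folklore] -/
theorem IsDiPernaLionsApproximateSolution.measurable_eTruncatedEntropyProduction_clamp {δ : ℝ}
    {f : ℝ → E → E → ℝ} (hf : IsDiPernaLionsApproximateSolution δ B f)
    (hBm : Measurable (Function.uncurry B)) (δ' : ℝ) :
    Measurable fun p : ℝ × E => eTruncatedEntropyProduction δ' B (f (max p.1 0) p.2) := by
  haveI := isFiniteMeasure_sphereMeasure (E := E)
  obtain ⟨hFm, -⟩ := hf.measurable_clamp_uncurry
  unfold eTruncatedEntropyProduction eEntropyProduction
  refine (hf.measurable_normalisingFactor_clamp δ').ennreal_ofReal.mul ?_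
  have hg : Measurable (Function.uncurry fun (p : ℝ × E) (w : E) => f (max p.1 0) p.2 w) :=
    hFm.comp (measurable_fst.fst.prodMk (measurable_fst.snd.prodMk measurable_snd))
  have h := measurable_entropyProductionIntegrand_param hBm hg
  exact ((measurable_const.mul h).ennreal_ofReal).lintegral_prod_right'

/-- **The dissipation majorant** `D̂(t,x,v) = ofReal a(t,x) ∫⁻_{(w,ω)} ofReal (B Γ)` of an
approximate solution (along the time clamp) is measurable. [folklore] -/
theorem IsDiPernaLionsApproximateSolution.measurable_dissipation_majorant {δ : ℝ}
    {f : ℝ → E → E → ℝ} (hf : IsDiPernaLionsApproximateSolution δ B f)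
    (hBm : Measurable (Function.uncurry B)) :
    Measurable fun z : ℝ × E × E => ENNReal.ofReal (1 + δ * ∫ w, |f (max z.1 0) z.2.1 w|)⁻¹ *
      ∫⁻ q, ENNReal.ofReal (entropyProductionIntegrand B (f (max z.1 0) z.2.1) ((z.2.2, q.1), q.2))
        ∂((volume : Measure E).prod sphereMeasure) := by
  haveI := isFiniteMeasure_sphereMeasure (E := E)
  obtain ⟨hFm, -⟩ := hf.measurable_clamp_uncurry
  have ha := (hf.measurable_normalisingFactor_clamp δ).comp
    (measurable_fst.prodMk measurable_snd.fst : Measurable fun z : ℝ × E × E => (z.1, z.2.1))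
  refine ha.ennreal_ofReal.mul ?_
  have hg : Measurable (Function.uncurry fun (z : ℝ × E × E) (w : E) => f (max z.1 0) z.2.1 w) :=
    hFm.comp (measurable_fst.fst.prodMk (measurable_fst.snd.fst.prodMk measurable_snd))
  have h := measurable_entropyProductionIntegrand_param hBm hg
  have h2 : Measurable fun p : (ℝ × E × E) × (E × sphere (0 : E) 1) =>
      ENNReal.ofReal (entropyProductionIntegrand B (f (max p.1.1 0) p.1.2.1) ((p.1.2.2, p.2.1), p.2.2)) :=
    (h.comp (measurable_fst.prodMk ((measurable_fst.snd.snd.prodMk measurable_snd.fst).prodMk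
      measurable_snd.snd))).ennreal_ofReal
  exact h2.lintegral_prod_right'

/-- **The slab integral of the dissipation majorant is controlled by the total dissipation**:
`∫⁻_{slab} D̂ₙ ≤ 4 ∫⁻_{(0,∞)×E} ẽₙ`. [folklore] -/
theorem lintegral_slab_dissipation_majorant_le {δ : ℝ} {f : ℝ → E → E → ℝ}
    (hf : IsDiPernaLionsApproximateSolution δ B f) (hBm : Measurable (Function.uncurry B)) (T : ℝ) :
    ∫⁻ z, ENNReal.ofReal (1 + δ * ∫ w, |f (max z.1 0) z.2.1 w|)⁻¹ *
        ∫⁻ q, ENNReal.ofReal (entropyProductionIntegrand B (f (max z.1 0) z.2.1) ((z.2.2, q.1), q.2))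
          ∂((volume : Measure E).prod sphereMeasure) ∂(slabMeasure E T) ≤
      4 * ∫⁻ p in Ioi (0 : ℝ) ×ˢ (univ : Set E), eTruncatedEntropyProduction δ B (f p.1 p.2)
        ∂((volume : Measure ℝ).prod volume) := by
  haveI := isFiniteMeasure_sphereMeasure (E := E)
  set D : ℝ × E × E → ℝ≥0∞ := fun z => ENNReal.ofReal (1 + δ * ∫ w, |f (max z.1 0) z.2.1 w|)⁻¹ *
    ∫⁻ q, ENNReal.ofReal (entropyProductionIntegrand B (f (max z.1 0) z.2.1) ((z.2.2, q.1), q.2))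
      ∂((volume : Measure E).prod sphereMeasure) with hD
  have hDm : Measurable D := hf.measurable_dissipation_majorant hBm
  have hEm : Measurable fun p : ℝ × E => eTruncatedEntropyProduction δ B (f (max p.1 0) p.2) :=
    hf.measurable_eTruncatedEntropyProduction_clamp hBm δ
  -- integrate over the slab
  rw [slabMeasure_eq_prod, lintegral_prod _ hDm.aemeasurable]
  have hslice : ∀ t ∈ Ioo (0 : ℝ) T, ∫⁻ y, D (t, y) ∂((volume : Measure E).prod volume) =
      ∫⁻ x, 4 * eTruncatedEntropyProduction δ B (f (max t 0) x) := by
    intro t ht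
    have e := lintegral_prod (μ := (volume : Measure E)) (ν := (volume : Measure E))
      (fun y : E × E => D (t, y)) (hDm.comp (measurable_const.prodMk measurable_id)).aemeasurable
    rw [e]
    refine lintegral_congr fun x => ?_
    simp only [hD]
    exact lintegral_dissipation_majorant_eq hBm
      ((hf.contDiff_slice (max t 0) (le_max_right _ _)).continuous.measurable.comp
        (measurable_const.prodMk measurable_id)) δ
  calc ∫⁻ t in Ioo 0 T, ∫⁻ y, D (t, y) ∂((volume : Measure E).prod volume)
      = ∫⁻ t in Ioo 0 T, ∫⁻ x, 4 * eTruncatedEntropyProduction δ B (f (max t 0) x) :=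
        setLIntegral_congr_fun measurableSet_Ioo hslice
    _ = 4 * ∫⁻ t in Ioo 0 T, ∫⁻ x, eTruncatedEntropyProduction δ B (f (max t 0) x) := by
        rw [← lintegral_const_mul' _ _ (by norm_num)]
        refine lintegral_congr fun t => ?_
        rw [lintegral_const_mul' _ _ (by norm_num)]
    _ = 4 * ∫⁻ p in Ioo (0 : ℝ) T ×ˢ (univ : Set E), eTruncatedEntropyProduction δ B (f (max p.1 0) p.2)
          ∂((volume : Measure ℝ).prod volume) := by
        rw [volume_prod_restrict_Ioo_univ, lintegral_prod _ hEm.aemeasurable]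
    _ = 4 * ∫⁻ p in Ioo (0 : ℝ) T ×ˢ (univ : Set E), eTruncatedEntropyProduction δ B (f p.1 p.2)
          ∂((volume : Measure ℝ).prod volume) := by
        congr 1
        refine setLIntegral_congr_fun (measurableSet_Ioo.prod MeasurableSet.univ) fun p hp => ?_
        rw [max_eq_left (le_of_lt hp.1.1)]
    _ ≤ 4 * ∫⁻ p in Ioi (0 : ℝ) ×ˢ (univ : Set E), eTruncatedEntropyProduction δ B (f p.1 p.2)
          ∂((volume : Measure ℝ).prod volume) := by
        gcongr
        exact Ioo_subset_Ioi_self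

end Dissipation

/-! ## Assembly: the approximating sequence on the restricted slab -/

section Assembly

variable {B : E × E → sphere (0 : E) 1 → ℝ} {δ : ℕ → ℝ} {Bseq : ℕ → E × E → sphere (0 : E) 1 → ℝ}
  {fseq : ℕ → ℝ → E → E → ℝ}

/-- The zero family is equi-integrable and uniformly tight. [folklore] -/
theorem unifIntegrable_unifTight_zero {α ι : Type*} [MeasurableSpace α] (μ : Measure α) :
    UnifIntegrable (fun (_ : ι) (_ : α) => (0 : ℝ)) 1 μ ∧ UnifTight (fun (_ : ι) (_ : α) => (0 : ℝ)) 1 μ := by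
  constructor
  · intro ε hε
    refine ⟨1, one_pos, fun i s _ _ => ?_⟩
    have : s.indicator (fun _ : α => (0 : ℝ)) = 0 := by funext x; simp [indicator]
    rw [this, eLpNorm_zero]; exact bot_le
  · intro ε hε
    refine ⟨∅, by simp, fun i => ?_⟩
    have : (∅ : Set α)ᶜ.indicator (fun _ : α => (0 : ℝ)) = 0 := by funext x; simp [indicator]
    rw [this, eLpNorm_zero]; exact bot_le

/-- Almost every point of the restricted slab has positive time. [folklore] -/
theorem ae_pos_time_restrict_slab_ball (T R : ℝ) :
    ∀ᵐ z : ℝ × E × E ∂((volume : Measure (ℝ × E × E)).restrict (Ioo 0 T ×ˢ (univ ×ˢ closedBall (0 : E) R))),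
      0 < z.1 := by
  filter_upwards [ae_restrict_mem (measurableSet_Ioo.prod (MeasurableSet.univ.prod measurableSet_closedBall))]
    with z hz
  exact hz.1.1

/-- The restricted slab measure is dominated by the slab measure. [folklore] -/
theorem restrict_slab_ball_le_slabMeasure (T R : ℝ) :
    (volume : Measure (ℝ × E × E)).restrict (Ioo 0 T ×ˢ (univ ×ˢ closedBall (0 : E) R)) ≤ slabMeasure E T := by
  rw [slabMeasure_def]
  exact Measure.restrict_mono (prod_mono subset_rfl (subset_univ _)) le_rfl

/-- Parametric measurability of the near and far parts: for measurable `φ` on `(ℝ × E × E) × E`,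
`z ↦ ∫⁻_{w ∈ B̄(v, K)} φ(z, w)` and `z ↦ ∫⁻_{w ∉ B̄(v, K)} φ(z, w)` are measurable. [folklore] -/
theorem measurable_setLIntegral_closedBall_param {φ : (ℝ × E × E) × E → ℝ≥0∞} (hφ : Measurable φ)
    (K : ℝ) :
    Measurable (fun z : ℝ × E × E => ∫⁻ w in closedBall z.2.2 K, φ (z, w)) ∧
      Measurable (fun z : ℝ × E × E => ∫⁻ w in (closedBall z.2.2 K)ᶜ, φ (z, w)) := by
  have hS : MeasurableSet {p : (ℝ × E × E) × E | dist p.2 p.1.2.2 ≤ K} :=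
    measurableSet_le (continuous_dist.measurable.comp (measurable_snd.prodMk measurable_fst.snd.snd))
      measurable_const
  constructor
  · have h := (hφ.indicator hS).lintegral_prod_right' (ν := (volume : Measure E))
    have heq : (fun z : ℝ × E × E => ∫⁻ w in closedBall z.2.2 K, φ (z, w)) =
        fun z => ∫⁻ y, {p : (ℝ × E × E) × E | dist p.2 p.1.2.2 ≤ K}.indicator φ (z, y) :=
      funext fun z => by rw [← lintegral_indicator measurableSet_closedBall]; rfl
    rw [heq]; exact h
  · have h := (hφ.indicator hS.compl).lintegral_prod_right' (ν := (volume : Measure E))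
    have heq : (fun z : ℝ × E × E => ∫⁻ w in (closedBall z.2.2 K)ᶜ, φ (z, w)) =
        fun z => ∫⁻ y, {p : (ℝ × E × E) × E | dist p.2 p.1.2.2 ≤ K}ᶜ.indicator φ (z, y) :=
      funext fun z => by rw [← lintegral_indicator measurableSet_closedBall.compl]; rfl
    rw [heq]; exact h

/-- **Equi-integrability package for the velocity convolutions `Aₙ ∗ fⁿ`** on the restricted slab
`(0,T) × E × B̄_R` (CIP 1994 Lemma 5.3.7, loss half: the bounded near part, the height tail and
the far part): for every `ε > 0` there is a constant `M_c` such that each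
`Ĉₙ = ∫⁻ ofReal (Aₙ(v-w) fⁿ(w)) dw` is `≤ M_c + dₙ` with `dₙ` measurable and `∫ dₙ ≤ ε`. [cite: CIPDiluteGases1994, §5.3 Lemma 5.3.7 (pp. 148–150)] -/
theorem exists_conv_dominated_split (hB : KineticTheory.IsDiPernaLionsKernel B)
    (hker : IsDiPernaLionsKernelApproximation B Bseq)
    (hsol : ∀ n, IsDiPernaLionsApproximateSolution (δ n) (Bseq n) (fseq n))
    (hbd : UniformDiPernaLionsBounds δ Bseq fseq) {T : ℝ} (hT : 0 < T) (R : ℝ) {ε : ℝ} (hε : 0 < ε) :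
    ∃ Mc : ℝ≥0, ∀ n, ∃ d : ℝ × E × E → ℝ≥0∞, Measurable d ∧
      ∫⁻ z, d z ∂((volume : Measure (ℝ × E × E)).restrict (Ioo 0 T ×ˢ (univ ×ˢ closedBall (0 : E) R))) ≤
        ENNReal.ofReal ε ∧
      ∀ z : ℝ × E × E, ∫⁻ w, ENNReal.ofReal (kernelAngularIntegral (Bseq n) (z.2.2 - w) *
          fseq n (max z.1 0) z.2.1 w) ≤ Mc + d z := by
  -- the uniform mass–moment–entropy constant
  obtain ⟨C, hC⟩ := hbd.massEntropy_le T hT.le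
  set C' : ℝ := max C 1 with hC'
  have hC'1 : 1 ≤ C' := le_max_right _ _
  have hCC' : ∀ n, ∀ t ∈ Icc 0 T, ∫⁻ z : E × E, ENNReal.ofReal (fseq n t z.1 z.2 *
      (1 + ‖z.1‖ ^ 2 + ‖z.2‖ ^ 2 + |log (fseq n t z.1 z.2)|)) ∂(volume.prod volume) ≤ ENNReal.ofReal C' :=
    fun n t ht => (hC n t ht).trans (ENNReal.ofReal_le_ofReal (le_max_left _ _))
  -- the far part: `ε₁`, `ρ`, `K₀`
  set ε₁ : ℝ := ε / (2 * (T * C' + 1)) with hε₁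
  have hε₁pos : 0 < ε₁ := by positivity
  obtain ⟨ρ, hρ⟩ := hker.uniform_growth R ε₁ hε₁pos
  set K₀ : ℝ := R + ρ with hK₀
  -- the near part: uniform angular mass `α` and the height `M'`
  obtain ⟨α, hα⟩ := exists_uniform_angular_mass hB hker K₀
  obtain ⟨hUIf, -⟩ := uniformIntegrable_unifTight_slab hsol hbd T
  set ε₂ : ℝ := ε / (2 * (α + 1)) with hε₂
  have hε₂pos : 0 < ε₂ := by positivity
  obtain ⟨M', hM'⟩ := hUIf.spec one_ne_zero ENNReal.one_ne_top hε₂pos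
  refine ⟨M' * α, fun n => ?_⟩
  -- data of the `n`-th term
  obtain ⟨hFm, hF0⟩ := (hsol n).measurable_clamp_uncurry
  set F : ℝ × E × E → ℝ := fun q => fseq n (max q.1 0) q.2.1 q.2.2 with hF
  set A : E → ℝ := kernelAngularIntegral (Bseq n) with hA
  have hBn := hker.isDiPernaLionsKernel n
  have hAm : Measurable A := measurable_kernelAngularIntegral hBn.measurable
  have hA0 : ∀ u, 0 ≤ A u := kernelAngularIntegral_nonneg hBn.nonneg
  obtain ⟨Cb, hCb⟩ := hker.bounded n
  have hAle : ∀ u, A u ≤ Cb * (sphereMeasure (E := E)).real univ :=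
    kernelAngularIntegral_le_of_bounded hBn.nonneg hCb
  -- the two small parts
  set dtail : ℝ × E × E → ℝ≥0∞ := fun z => ∫⁻ w in closedBall z.2.2 K₀,
    ENNReal.ofReal (A (z.2.2 - w) * (F (z.1, z.2.1, w) - min (F (z.1, z.2.1, w)) M')) with hdtail
  set dfar : ℝ × E × E → ℝ≥0∞ := fun z => ∫⁻ w in (closedBall z.2.2 K₀)ᶜ,
    ENNReal.ofReal (A (z.2.2 - w) * F (z.1, z.2.1, w)) with hdfar
  have hφtail : Measurable fun p : (ℝ × E × E) × E =>
      ENNReal.ofReal (A (p.1.2.2 - p.2) * (F (p.1.1, p.1.2.1, p.2) - min (F (p.1.1, p.1.2.1, p.2)) M')) := by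
    have hF' : Measurable fun p : (ℝ × E × E) × E => F (p.1.1, p.1.2.1, p.2) :=
      hFm.comp (measurable_fst.fst.prodMk (measurable_fst.snd.fst.prodMk measurable_snd))
    exact ((hAm.comp (measurable_fst.snd.snd.sub measurable_snd)).mul
      (hF'.sub (hF'.min measurable_const))).ennreal_ofReal
  have hφfar : Measurable fun p : (ℝ × E × E) × E =>
      ENNReal.ofReal (A (p.1.2.2 - p.2) * F (p.1.1, p.1.2.1, p.2)) :=
    ((hAm.comp (measurable_fst.snd.snd.sub measurable_snd)).mul
      (hFm.comp (measurable_fst.fst.prodMk (measurable_fst.snd.fst.prodMk measurable_snd)))).ennreal_ofReal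
  have hdtailm : Measurable dtail := (measurable_setLIntegral_closedBall_param hφtail K₀).1
  have hdfarm : Measurable dfar := (measurable_setLIntegral_closedBall_param hφfar K₀).2
  refine ⟨fun z => dtail z + dfar z, hdtailm.add hdfarm, ?_, ?_⟩
  · -- the integral of the small parts
    rw [lintegral_add_left hdtailm]
    have hhalf : ENNReal.ofReal (ε / 2) + ENNReal.ofReal (ε / 2) = ENNReal.ofReal ε := by
      rw [← ENNReal.ofReal_add (by positivity) (by positivity), add_halves]
    rw [← hhalf]
    refine add_le_add ?_ ?_
    · -- the height tail, through the slab and the equi-integrability of `(fⁿ)`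
      have h1 : ∫⁻ z, dtail z ∂((volume : Measure (ℝ × E × E)).restrict
          (Ioo 0 T ×ˢ (univ ×ˢ closedBall (0 : E) R))) ≤ ∫⁻ z, dtail z ∂(slabMeasure E T) :=
        lintegral_mono' (restrict_slab_ball_le_slabMeasure T R) le_rfl
      have hΨm : Measurable fun q : ℝ × E × E => ENNReal.ofReal (F q - min (F q) M') :=
        (hFm.sub (hFm.min measurable_const)).ennreal_ofReal
      have h2 : ∫⁻ z, dtail z ∂(slabMeasure E T) =
          (∫⁻ u in closedBall (0 : E) K₀, ENNReal.ofReal (A u)) *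
            ∫⁻ q, ENNReal.ofReal (F q - min (F q) M') ∂(slabMeasure E T) := by
        rw [← lintegral_slab_near_conv_eq hAm hΨm T K₀]
        refine lintegral_congr fun z => setLIntegral_congr_fun measurableSet_closedBall fun w _ => ?_
        rw [ENNReal.ofReal_mul (hA0 _)]
      have h3 : ∫⁻ q, ENNReal.ofReal (F q - min (F q) M') ∂(slabMeasure E T) ≤ ENNReal.ofReal ε₂ := by
        refine le_trans ?_ (hM' n)
        rw [eLpNorm_one_eq_lintegral_enorm]
        refine lintegral_mono_ae ?_
        rw [slabMeasure_def]
        filter_upwards [ae_restrict_mem (measurableSet_Ioo.prod MeasurableSet.univ)] with q hq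
        have hq0 : max q.1 0 = q.1 := max_eq_left (le_of_lt hq.1.1)
        have hle := ofReal_sub_min_le_enorm_indicator hF0 M' q
        have hFq : F q = fseq n q.1 q.2.1 q.2.2 := by simp only [hF, hq0]
        refine hle.trans (le_of_eq ?_)
        simp only [enorm_indicator_eq_indicator_enorm]
        by_cases hmem : q ∈ {q : ℝ × E × E | M' ≤ ‖F q‖₊}
        · rw [indicator_of_mem hmem, indicator_of_mem (by simpa [hFq] using hmem)]
          simp only [hq0]
        · rw [indicator_of_notMem hmem, indicator_of_notMem (by simpa [hFq] using hmem)]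
      calc ∫⁻ z, dtail z ∂((volume : Measure (ℝ × E × E)).restrict (Ioo 0 T ×ˢ (univ ×ˢ closedBall (0 : E) R)))
          ≤ (∫⁻ u in closedBall (0 : E) K₀, ENNReal.ofReal (A u)) *
              ∫⁻ q, ENNReal.ofReal (F q - min (F q) M') ∂(slabMeasure E T) := h1.trans h2.le
        _ ≤ (α : ℝ≥0∞) * ENNReal.ofReal ε₂ := mul_le_mul (hα n) h3 bot_le bot_le
        _ = ENNReal.ofReal (α * ε₂) := coe_nnreal_mul_ofReal _ _
        _ ≤ ENNReal.ofReal (ε / 2) := by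
            refine ENNReal.ofReal_le_ofReal ?_
            rw [hε₂, mul_div_assoc', div_le_div_iff₀ (by positivity) (by positivity)]
            nlinarith [NNReal.coe_nonneg α, hε]
    · -- the far part, by the growth condition
      have hgrowth : ∀ u : E, ρ ≤ ‖u‖ →
          ∫⁻ z in closedBall u R, ENNReal.ofReal (A z) ≤ ENNReal.ofReal (ε₁ * (1 + ‖u‖ ^ 2)) :=
        fun u hu => setLIntegral_ofReal_le_of_growth hAm hA0 hAle (fun u hu => hρ n u hu) u hu
      have h1 := lintegral_far_le_of_growth (T := T) hAm hA0 hFm hF0 hε₁pos.le (le_of_eq hK₀.symm) hgrowth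
      have h2 : ∫⁻ q, ENNReal.ofReal ((1 + ‖q.2.2‖ ^ 2) * F q) ∂(slabMeasure E T) ≤
          ENNReal.ofReal T * ENNReal.ofReal C' := by
        have := lintegral_slab_weight_le hsol hCC' n (g := fun q : ℝ × E × E => 1 + ‖q.2.2‖ ^ 2)
          (by fun_prop) (fun q _ => ⟨by positivity, by
            nlinarith [sq_nonneg ‖q.2.1‖, abs_nonneg (log (fseq n q.1 q.2.1 q.2.2))]⟩)
        refine le_trans (le_of_eq (lintegral_congr fun q => by rw [mul_comm])) this
      calc ∫⁻ z, dfar z ∂((volume : Measure (ℝ × E × E)).restrict (Ioo 0 T ×ˢ (univ ×ˢ closedBall (0 : E) R)))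
          ≤ ENNReal.ofReal ε₁ * (ENNReal.ofReal T * ENNReal.ofReal C') :=
            h1.trans (mul_le_mul_of_nonneg_left h2 bot_le)
        _ = ENNReal.ofReal (ε₁ * (T * C')) := by
            rw [← ENNReal.ofReal_mul hT.le, ← ENNReal.ofReal_mul hε₁pos.le]
        _ ≤ ENNReal.ofReal (ε / 2) := by
            refine ENNReal.ofReal_le_ofReal ?_
            rw [hε₁, div_mul_eq_mul_div, div_le_div_iff₀ (by positivity) (by positivity)]
            nlinarith [hε, mul_nonneg hT.le (by linarith : (0 : ℝ) ≤ C')]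
  · -- the domination `Ĉ ≤ M' α + dtail + dfar`
    intro z
    rw [lintegral_conv_eq_near_add_far A F K₀ z, lintegral_near_eq_bdd_add_tail hA0 hF0 hAm hFm K₀
      (NNReal.coe_nonneg M') z]
    have hbdd := lintegral_near_bdd_le (F := F) hA0 K₀ (M' : ℝ) z
    have hM : ENNReal.ofReal (M' : ℝ) * ∫⁻ u in closedBall (0 : E) K₀, ENNReal.ofReal (A u) ≤
        ((M' * α : ℝ≥0) : ℝ≥0∞) := by
      rw [ENNReal.ofReal_coe_nnreal, ENNReal.coe_mul]
      exact mul_le_mul_of_nonneg_left (hα n) bot_le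
    calc _ ≤ ((M' * α : ℝ≥0) : ℝ≥0∞) + dtail z + dfar z := by
          exact add_le_add (add_le_add (hbdd.trans hM) le_rfl) le_rfl
      _ = _ := by rw [add_assoc]

/-- **Tightness package for the velocity convolutions** (CIP 1994 Lemma 5.3.7, (ii c)): for every
`ε > 0` there is `ρ'` such that off `{|x| ≤ ρ'}` each `Ĉₙ` is dominated by a measurable `dₙ`
with `∫ dₙ ≤ ε` (second `x`-moments for the near part, the growth condition for the far part). [cite: CIPDiluteGases1994, §5.3 Lemma 5.3.7 (pp. 148–150)] -/
theorem exists_conv_dominated_off_ball (hB : KineticTheory.IsDiPernaLionsKernel B)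
    (hker : IsDiPernaLionsKernelApproximation B Bseq)
    (hsol : ∀ n, IsDiPernaLionsApproximateSolution (δ n) (Bseq n) (fseq n))
    (hbd : UniformDiPernaLionsBounds δ Bseq fseq) {T : ℝ} (hT : 0 < T) (R : ℝ) {ε : ℝ} (hε : 0 < ε) :
    ∃ ρ' : ℝ, ∀ n, ∃ d : ℝ × E × E → ℝ≥0∞, Measurable d ∧
      ∫⁻ z, d z ∂((volume : Measure (ℝ × E × E)).restrict (Ioo 0 T ×ˢ (univ ×ˢ closedBall (0 : E) R))) ≤
        ENNReal.ofReal ε ∧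
      ∀ z : ℝ × E × E, ρ' < ‖z.2.1‖ → ∫⁻ w, ENNReal.ofReal (kernelAngularIntegral (Bseq n) (z.2.2 - w) *
          fseq n (max z.1 0) z.2.1 w) ≤ d z := by
  obtain ⟨C, hC⟩ := hbd.massEntropy_le T hT.le
  set C' : ℝ := max C 1 with hC'
  have hC'1 : 1 ≤ C' := le_max_right _ _
  have hCC' : ∀ n, ∀ t ∈ Icc 0 T, ∫⁻ z : E × E, ENNReal.ofReal (fseq n t z.1 z.2 *
      (1 + ‖z.1‖ ^ 2 + ‖z.2‖ ^ 2 + |log (fseq n t z.1 z.2)|)) ∂(volume.prod volume) ≤ ENNReal.ofReal C' :=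
    fun n t ht => (hC n t ht).trans (ENNReal.ofReal_le_ofReal (le_max_left _ _))
  set ε₁ : ℝ := ε / (2 * (T * C' + 1)) with hε₁
  have hε₁pos : 0 < ε₁ := by positivity
  obtain ⟨ρ, hρ⟩ := hker.uniform_growth R ε₁ hε₁pos
  set K₀ : ℝ := R + ρ with hK₀
  obtain ⟨α, hα⟩ := exists_uniform_angular_mass hB hker K₀
  -- the radius `ρ'`
  set ρ' : ℝ := Real.sqrt (2 * α * T * C' / ε) + 1 with hρ'
  have hρ'1 : 1 ≤ ρ' := by rw [hρ']; linarith [Real.sqrt_nonneg (2 * α * T * C' / ε)]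
  have hρ'0 : 0 < ρ' := by linarith
  have hkey : (α : ℝ) * (ρ' ^ 2)⁻¹ * (T * C') ≤ ε / 2 := by
    have hsq : 2 * α * T * C' / ε ≤ ρ' ^ 2 := by
      have h1 : Real.sqrt (2 * α * T * C' / ε) ^ 2 = 2 * α * T * C' / ε := Real.sq_sqrt (by positivity)
      nlinarith [Real.sqrt_nonneg (2 * α * T * C' / ε)]
    rw [div_le_iff₀ hε] at hsq
    rw [mul_comm, ← div_eq_mul_inv, ← mul_div_assoc, div_le_iff₀ (by positivity)]
    nlinarith [NNReal.coe_nonneg α]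
  refine ⟨ρ', fun n => ?_⟩
  obtain ⟨hFm, hF0⟩ := (hsol n).measurable_clamp_uncurry
  set F : ℝ × E × E → ℝ := fun q => fseq n (max q.1 0) q.2.1 q.2.2 with hF
  set A : E → ℝ := kernelAngularIntegral (Bseq n) with hA
  have hBn := hker.isDiPernaLionsKernel n
  have hAm : Measurable A := measurable_kernelAngularIntegral hBn.measurable
  have hA0 : ∀ u, 0 ≤ A u := kernelAngularIntegral_nonneg hBn.nonneg
  obtain ⟨Cb, hCb⟩ := hker.bounded n
  have hAle : ∀ u, A u ≤ Cb * (sphereMeasure (E := E)).real univ :=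
    kernelAngularIntegral_le_of_bounded hBn.nonneg hCb
  set S : Set (ℝ × E × E) := {z | ρ' < ‖z.2.1‖} with hS
  have hSm : MeasurableSet S := measurableSet_lt measurable_const measurable_snd.fst.norm
  set dnear : ℝ × E × E → ℝ≥0∞ := fun z => ∫⁻ w in closedBall z.2.2 K₀,
    ENNReal.ofReal (A (z.2.2 - w) * F (z.1, z.2.1, w)) with hdnear
  set dfar : ℝ × E × E → ℝ≥0∞ := fun z => ∫⁻ w in (closedBall z.2.2 K₀)ᶜ,
    ENNReal.ofReal (A (z.2.2 - w) * F (z.1, z.2.1, w)) with hdfar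
  have hφ : Measurable fun p : (ℝ × E × E) × E =>
      ENNReal.ofReal (A (p.1.2.2 - p.2) * F (p.1.1, p.1.2.1, p.2)) :=
    ((hAm.comp (measurable_fst.snd.snd.sub measurable_snd)).mul
      (hFm.comp (measurable_fst.fst.prodMk (measurable_fst.snd.fst.prodMk measurable_snd)))).ennreal_ofReal
  have hdnearm : Measurable dnear := (measurable_setLIntegral_closedBall_param hφ K₀).1
  have hdfarm : Measurable dfar := (measurable_setLIntegral_closedBall_param hφ K₀).2
  refine ⟨fun z => S.indicator dnear z + dfar z, (hdnearm.indicator hSm).add hdfarm, ?_, ?_⟩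
  · rw [lintegral_add_left (hdnearm.indicator hSm)]
    have hhalf : ENNReal.ofReal (ε / 2) + ENNReal.ofReal (ε / 2) = ENNReal.ofReal ε := by
      rw [← ENNReal.ofReal_add (by positivity) (by positivity), add_halves]
    rw [← hhalf]
    refine add_le_add ?_ ?_
    · -- the near part off the ball: second `x`-moments
      set Ψ : ℝ × E × E → ℝ≥0∞ := fun q => {q : ℝ × E × E | ρ' < ‖q.2.1‖}.indicator
        (fun q => ENNReal.ofReal (F q)) q with hΨ
      have hΨm : Measurable Ψ := hFm.ennreal_ofReal.indicator hSm
      have h1 : ∫⁻ z, S.indicator dnear z ∂((volume : Measure (ℝ × E × E)).restrict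
          (Ioo 0 T ×ˢ (univ ×ˢ closedBall (0 : E) R))) ≤ ∫⁻ z, S.indicator dnear z ∂(slabMeasure E T) :=
        lintegral_mono' (restrict_slab_ball_le_slabMeasure T R) le_rfl
      have h2 : ∫⁻ z, S.indicator dnear z ∂(slabMeasure E T) =
          (∫⁻ u in closedBall (0 : E) K₀, ENNReal.ofReal (A u)) * ∫⁻ q, Ψ q ∂(slabMeasure E T) := by
        rw [← lintegral_slab_near_conv_eq hAm hΨm T K₀]
        refine lintegral_congr fun z => ?_
        by_cases hz : z ∈ S
        · rw [indicator_of_mem hz]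
          refine setLIntegral_congr_fun measurableSet_closedBall fun w _ => ?_
          have hz' : ((z.1, z.2.1, w) : ℝ × E × E) ∈ {q : ℝ × E × E | ρ' < ‖q.2.1‖} := hz
          simp only [hΨ, indicator_of_mem hz', ENNReal.ofReal_mul (hA0 _)]
        · rw [indicator_of_notMem hz]
          have hz' : ∀ w : E, ((z.1, z.2.1, w) : ℝ × E × E) ∉ {q : ℝ × E × E | ρ' < ‖q.2.1‖} :=
            fun w h => hz h
          have h0 : ∀ w : E, ENNReal.ofReal (A (z.2.2 - w)) * Ψ (z.1, z.2.1, w) = 0 := fun w => by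
            simp only [hΨ, indicator_of_notMem (hz' w), mul_zero]
          simp only [h0, lintegral_const, zero_mul]
      have h3 : ∫⁻ q, Ψ q ∂(slabMeasure E T) ≤
          ENNReal.ofReal (ρ' ^ 2)⁻¹ * (ENNReal.ofReal T * ENNReal.ofReal C') := by
        have hw := lintegral_slab_weight_le hsol hCC' n (g := fun q : ℝ × E × E => ‖q.2.1‖ ^ 2)
          (by fun_prop) (fun q _ => ⟨by positivity, by
            nlinarith [sq_nonneg ‖q.2.2‖, abs_nonneg (log (fseq n q.1 q.2.1 q.2.2))]⟩)
        refine le_trans ?_ ((mul_le_mul_of_nonneg_left hw bot_le))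
        rw [← lintegral_const_mul' _ _ ENNReal.ofReal_ne_top]
        refine lintegral_mono fun q => ?_
        by_cases hq : q ∈ {q : ℝ × E × E | ρ' < ‖q.2.1‖}
        · simp only [hΨ, indicator_of_mem hq]
          rw [← ENNReal.ofReal_mul (by positivity)]
          refine ENNReal.ofReal_le_ofReal ?_
          have hx : ρ' < ‖q.2.1‖ := hq
          have h1 : 1 ≤ (ρ' ^ 2)⁻¹ * ‖q.2.1‖ ^ 2 := by
            rw [inv_mul_eq_div, one_le_div (by positivity)]
            nlinarith
          have := hF0 q
          calc F q = F q * 1 := (mul_one _).symm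
            _ ≤ F q * ((ρ' ^ 2)⁻¹ * ‖q.2.1‖ ^ 2) := mul_le_mul_of_nonneg_left h1 this
            _ = (ρ' ^ 2)⁻¹ * (F q * ‖q.2.1‖ ^ 2) := by ring
        · simp only [hΨ, indicator_of_notMem hq]; exact bot_le
      calc ∫⁻ z, S.indicator dnear z ∂((volume : Measure (ℝ × E × E)).restrict
            (Ioo 0 T ×ˢ (univ ×ˢ closedBall (0 : E) R)))
          ≤ (α : ℝ≥0∞) * (ENNReal.ofReal (ρ' ^ 2)⁻¹ * (ENNReal.ofReal T * ENNReal.ofReal C')) :=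
            (h1.trans h2.le).trans (mul_le_mul (hα n) h3 bot_le bot_le)
        _ = ENNReal.ofReal (α * ((ρ' ^ 2)⁻¹ * (T * C'))) := by
            rw [← ENNReal.ofReal_mul hT.le, ← ENNReal.ofReal_mul (by positivity), coe_nnreal_mul_ofReal]
        _ ≤ ENNReal.ofReal (ε / 2) := ENNReal.ofReal_le_ofReal (by nlinarith [hkey])
    · -- the far part
      have hgrowth : ∀ u : E, ρ ≤ ‖u‖ →
          ∫⁻ z in closedBall u R, ENNReal.ofReal (A z) ≤ ENNReal.ofReal (ε₁ * (1 + ‖u‖ ^ 2)) :=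
        fun u hu => setLIntegral_ofReal_le_of_growth hAm hA0 hAle (fun u hu => hρ n u hu) u hu
      have h1 := lintegral_far_le_of_growth (T := T) hAm hA0 hFm hF0 hε₁pos.le (le_of_eq hK₀.symm) hgrowth
      have h2 : ∫⁻ q, ENNReal.ofReal ((1 + ‖q.2.2‖ ^ 2) * F q) ∂(slabMeasure E T) ≤
          ENNReal.ofReal T * ENNReal.ofReal C' := by
        have := lintegral_slab_weight_le hsol hCC' n (g := fun q : ℝ × E × E => 1 + ‖q.2.2‖ ^ 2)
          (by fun_prop) (fun q _ => ⟨by positivity, by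
            nlinarith [sq_nonneg ‖q.2.1‖, abs_nonneg (log (fseq n q.1 q.2.1 q.2.2))]⟩)
        refine le_trans (le_of_eq (lintegral_congr fun q => by rw [mul_comm])) this
      calc ∫⁻ z, dfar z ∂((volume : Measure (ℝ × E × E)).restrict (Ioo 0 T ×ˢ (univ ×ˢ closedBall (0 : E) R)))
          ≤ ENNReal.ofReal ε₁ * (ENNReal.ofReal T * ENNReal.ofReal C') :=
            h1.trans (mul_le_mul_of_nonneg_left h2 bot_le)
        _ = ENNReal.ofReal (ε₁ * (T * C')) := by
            rw [← ENNReal.ofReal_mul hT.le, ← ENNReal.ofReal_mul hε₁pos.le]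
        _ ≤ ENNReal.ofReal (ε / 2) := by
            refine ENNReal.ofReal_le_ofReal ?_
            rw [hε₁, div_mul_eq_mul_div, div_le_div_iff₀ (by positivity) (by positivity)]
            nlinarith [hε, mul_nonneg hT.le (by linarith : (0 : ℝ) ≤ C')]
  · intro z hz
    show _ ≤ S.indicator dnear z + dfar z
    rw [lintegral_conv_eq_near_add_far A F K₀ z, indicator_of_mem (show z ∈ S from hz)]

/-- **Uniform `L¹` bound for the velocity convolutions** on the restricted slab. [cite: CIPDiluteGases1994, §5.3 Lemma 5.3.7 (ii a) (p. 148)] -/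
theorem exists_conv_lintegral_le (hB : KineticTheory.IsDiPernaLionsKernel B)
    (hker : IsDiPernaLionsKernelApproximation B Bseq)
    (hsol : ∀ n, IsDiPernaLionsApproximateSolution (δ n) (Bseq n) (fseq n))
    (hbd : UniformDiPernaLionsBounds δ Bseq fseq) {T : ℝ} (hT : 0 < T) (R : ℝ) :
    ∃ CL : ℝ≥0, ∀ n,
      ∫⁻ z, (∫⁻ w, ENNReal.ofReal (kernelAngularIntegral (Bseq n) (z.2.2 - w) * fseq n (max z.1 0) z.2.1 w))
        ∂((volume : Measure (ℝ × E × E)).restrict (Ioo 0 T ×ˢ (univ ×ˢ closedBall (0 : E) R))) ≤ CL := by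
  obtain ⟨C, hC⟩ := hbd.massEntropy_le T hT.le
  set C' : ℝ := max C 1 with hC'
  have hC'1 : 1 ≤ C' := le_max_right _ _
  have hCC' : ∀ n, ∀ t ∈ Icc 0 T, ∫⁻ z : E × E, ENNReal.ofReal (fseq n t z.1 z.2 *
      (1 + ‖z.1‖ ^ 2 + ‖z.2‖ ^ 2 + |log (fseq n t z.1 z.2)|)) ∂(volume.prod volume) ≤ ENNReal.ofReal C' :=
    fun n t ht => (hC n t ht).trans (ENNReal.ofReal_le_ofReal (le_max_left _ _))
  obtain ⟨ρ, hρ⟩ := hker.uniform_growth R 1 one_pos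
  set K₀ : ℝ := R + ρ with hK₀
  obtain ⟨α, hα⟩ := exists_uniform_angular_mass hB hker K₀
  refine ⟨((α + 1) * (T * C')).toNNReal, fun n => ?_⟩
  obtain ⟨hFm, hF0⟩ := (hsol n).measurable_clamp_uncurry
  set F : ℝ × E × E → ℝ := fun q => fseq n (max q.1 0) q.2.1 q.2.2 with hF
  set A : E → ℝ := kernelAngularIntegral (Bseq n) with hA
  have hBn := hker.isDiPernaLionsKernel n
  have hAm : Measurable A := measurable_kernelAngularIntegral hBn.measurable
  have hA0 : ∀ u, 0 ≤ A u := kernelAngularIntegral_nonneg hBn.nonneg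
  obtain ⟨Cb, hCb⟩ := hker.bounded n
  have hAle : ∀ u, A u ≤ Cb * (sphereMeasure (E := E)).real univ :=
    kernelAngularIntegral_le_of_bounded hBn.nonneg hCb
  have hφ : Measurable fun p : (ℝ × E × E) × E =>
      ENNReal.ofReal (A (p.1.2.2 - p.2) * F (p.1.1, p.1.2.1, p.2)) :=
    ((hAm.comp (measurable_fst.snd.snd.sub measurable_snd)).mul
      (hFm.comp (measurable_fst.fst.prodMk (measurable_fst.snd.fst.prodMk measurable_snd)))).ennreal_ofReal
  have hdnearm := (measurable_setLIntegral_closedBall_param hφ K₀).1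
  -- near part ≤ α T C'
  have hnear : ∫⁻ z, (∫⁻ w in closedBall z.2.2 K₀, ENNReal.ofReal (A (z.2.2 - w) * F (z.1, z.2.1, w)))
      ∂((volume : Measure (ℝ × E × E)).restrict (Ioo 0 T ×ˢ (univ ×ˢ closedBall (0 : E) R))) ≤
      (α : ℝ≥0∞) * (ENNReal.ofReal T * ENNReal.ofReal C') := by
    have h1 := lintegral_mono' (restrict_slab_ball_le_slabMeasure (E := E) T R)
      (le_refl fun z : ℝ × E × E => ∫⁻ w in closedBall z.2.2 K₀, ENNReal.ofReal (A (z.2.2 - w) * F (z.1, z.2.1, w)))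
    have hΨm : Measurable fun q : ℝ × E × E => ENNReal.ofReal (F q) := hFm.ennreal_ofReal
    have h2 : ∫⁻ z, (∫⁻ w in closedBall z.2.2 K₀, ENNReal.ofReal (A (z.2.2 - w) * F (z.1, z.2.1, w)))
        ∂(slabMeasure E T) = (∫⁻ u in closedBall (0 : E) K₀, ENNReal.ofReal (A u)) *
          ∫⁻ q, ENNReal.ofReal (F q) ∂(slabMeasure E T) := by
      rw [← lintegral_slab_near_conv_eq hAm hΨm T K₀]
      refine lintegral_congr fun z => setLIntegral_congr_fun measurableSet_closedBall fun w _ => ?_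
      rw [ENNReal.ofReal_mul (hA0 _)]
    have h3 : ∫⁻ q, ENNReal.ofReal (F q) ∂(slabMeasure E T) ≤ ENNReal.ofReal T * ENNReal.ofReal C' := by
      have := lintegral_slab_weight_le hsol hCC' n (g := fun _ : ℝ × E × E => (1 : ℝ)) measurable_const
        (fun q _ => ⟨zero_le_one, by
          nlinarith [sq_nonneg ‖q.2.1‖, sq_nonneg ‖q.2.2‖, abs_nonneg (log (fseq n q.1 q.2.1 q.2.2))]⟩)
      simpa only [mul_one] using this
    exact (h1.trans h2.le).trans (mul_le_mul (hα n) h3 bot_le bot_le)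
  -- far part ≤ T C'
  have hfar : ∫⁻ z, (∫⁻ w in (closedBall z.2.2 K₀)ᶜ, ENNReal.ofReal (A (z.2.2 - w) * F (z.1, z.2.1, w)))
      ∂((volume : Measure (ℝ × E × E)).restrict (Ioo 0 T ×ˢ (univ ×ˢ closedBall (0 : E) R))) ≤
      ENNReal.ofReal T * ENNReal.ofReal C' := by
    have hgrowth : ∀ u : E, ρ ≤ ‖u‖ →
        ∫⁻ z in closedBall u R, ENNReal.ofReal (A z) ≤ ENNReal.ofReal (1 * (1 + ‖u‖ ^ 2)) :=
      fun u hu => setLIntegral_ofReal_le_of_growth hAm hA0 hAle (fun u hu => hρ n u hu) u hu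
    have h1 := lintegral_far_le_of_growth (T := T) hAm hA0 hFm hF0 zero_le_one (le_of_eq hK₀.symm) hgrowth
    have h2 : ∫⁻ q, ENNReal.ofReal ((1 + ‖q.2.2‖ ^ 2) * F q) ∂(slabMeasure E T) ≤
        ENNReal.ofReal T * ENNReal.ofReal C' := by
      have := lintegral_slab_weight_le hsol hCC' n (g := fun q : ℝ × E × E => 1 + ‖q.2.2‖ ^ 2)
        (by fun_prop) (fun q _ => ⟨by positivity, by
          nlinarith [sq_nonneg ‖q.2.1‖, abs_nonneg (log (fseq n q.1 q.2.1 q.2.2))]⟩)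
      refine le_trans (le_of_eq (lintegral_congr fun q => by rw [mul_comm])) this
    calc _ ≤ ENNReal.ofReal 1 * (ENNReal.ofReal T * ENNReal.ofReal C') := h1.trans (mul_le_mul_of_nonneg_left h2 bot_le)
      _ = _ := by rw [ENNReal.ofReal_one, one_mul]
  calc ∫⁻ z, (∫⁻ w, ENNReal.ofReal (kernelAngularIntegral (Bseq n) (z.2.2 - w) * fseq n (max z.1 0) z.2.1 w))
        ∂((volume : Measure (ℝ × E × E)).restrict (Ioo 0 T ×ˢ (univ ×ˢ closedBall (0 : E) R)))
      = ∫⁻ z, ((∫⁻ w in closedBall z.2.2 K₀, ENNReal.ofReal (A (z.2.2 - w) * F (z.1, z.2.1, w))) +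
          ∫⁻ w in (closedBall z.2.2 K₀)ᶜ, ENNReal.ofReal (A (z.2.2 - w) * F (z.1, z.2.1, w)))
          ∂((volume : Measure (ℝ × E × E)).restrict (Ioo 0 T ×ˢ (univ ×ˢ closedBall (0 : E) R))) :=
        lintegral_congr fun z => lintegral_conv_eq_near_add_far A F K₀ z
    _ ≤ (α : ℝ≥0∞) * (ENNReal.ofReal T * ENNReal.ofReal C') + ENNReal.ofReal T * ENNReal.ofReal C' := by
        rw [lintegral_add_left hdnearm]; exact add_le_add hnear hfar
    _ = ENNReal.ofReal ((α + 1) * (T * C')) := by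
        rw [← ENNReal.ofReal_mul hT.le, ← ENNReal.ofReal_coe_nnreal,
          ← ENNReal.ofReal_mul (NNReal.coe_nonneg α), ← ENNReal.ofReal_add (by positivity) (by positivity)]
        congr 1; ring

/-- The restricted slab has finite measure on `{|x| ≤ ρ'}`. [folklore] -/
theorem restrict_slab_ball_measure_xBall_ne_top (T R ρ' : ℝ) :
    (volume : Measure (ℝ × E × E)).restrict (Ioo 0 T ×ˢ (univ ×ˢ closedBall (0 : E) R))
      {z : ℝ × E × E | ‖z.2.1‖ ≤ ρ'} ≠ ∞ := by
  have hSm : MeasurableSet {z : ℝ × E × E | ‖z.2.1‖ ≤ ρ'} :=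
    measurableSet_le measurable_snd.fst.norm measurable_const
  rw [Measure.restrict_apply hSm]
  have hsub : {z : ℝ × E × E | ‖z.2.1‖ ≤ ρ'} ∩ Ioo 0 T ×ˢ (univ ×ˢ closedBall (0 : E) R) ⊆
      Ioo 0 T ×ˢ (closedBall (0 : E) ρ' ×ˢ closedBall (0 : E) R) := by
    rintro ⟨t, x, v⟩ ⟨hx, ht, -, hv⟩
    exact ⟨ht, mem_closedBall_zero_iff.2 hx, hv⟩
  refine ne_top_of_le_ne_top ?_ (measure_mono hsub)
  rw [show (volume : Measure (ℝ × E × E)) = (volume : Measure ℝ).prod ((volume : Measure E).prod volume)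
    from rfl, Measure.prod_prod, Measure.prod_prod, Real.volume_Ioo]
  exact ENNReal.mul_ne_top ENNReal.ofReal_ne_top
    (ENNReal.mul_ne_top measure_closedBall_lt_top.ne measure_closedBall_lt_top.ne)

universe u in
/-- **Discharge of `diPernaLions_approx_collisionTerms_weaklyCompact`** (CIP 1994 §5.3 Lemma 5.3.7,
p. 148, with its proof pp. 148–150 and (3.27) p. 160): on every restricted slab
`(0,T) × E × B̄_R`, the normalised renormalised loss terms `a Q⁻ₙ(fⁿ,fⁿ)/(1+fⁿ)` are dominated by the
velocity convolutions `Aₙ ∗ fⁿ`, which are equi-integrable and uniformly tight by the bounded near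
part, the height tail (equi-integrability of `(fⁿ)` from the entropy bound), the far part (growth
condition (3.12)) and the `x`-moments; the gain terms are dominated by `K ×` the loss terms plus
`(log K)⁻¹ ×` the entropy dissipation (Arkeryd's inequality and (3.23)). [cite: CIPDiluteGases1994, §5.3 Lemma 5.3.7 (pp. 148–150)] -/
theorem diPernaLions_approx_collisionTerms_weaklyCompact_holds :
    diPernaLions_approx_collisionTerms_weaklyCompact.{u} := by
  intro E _ _ _ _ _ B hB f₀ hf₀ δ Bseq fseq hδ hanti hlim hker hdata hsol hbd T R
  set μR : Measure (ℝ × E × E) := (volume : Measure (ℝ × E × E)).restrict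
    (Ioo 0 T ×ˢ (univ ×ˢ closedBall (0 : E) R)) with hμR
  set L : ℕ → ℝ × E × E → ℝ := fun n z => (1 + δ n * ∫ w, |fseq n z.1 z.2.1 w|)⁻¹ *
    lossWith (Bseq n) (fseq n z.1 z.2.1) (fseq n z.1 z.2.1) z.2.2 / (1 + fseq n z.1 z.2.1 z.2.2) with hL
  set G : ℕ → ℝ × E × E → ℝ := fun n z => (1 + δ n * ∫ w, |fseq n z.1 z.2.1 w|)⁻¹ *
    gainWith (Bseq n) (fseq n z.1 z.2.1) (fseq n z.1 z.2.1) z.2.2 / (1 + fseq n z.1 z.2.1 z.2.2) with hG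
  -- the trivial case of an empty slab
  rcases le_or_gt T 0 with hT | hT
  · have hzero : μR = 0 := by
      rw [hμR, Ioo_eq_empty (not_lt.2 hT), empty_prod, Measure.restrict_empty]
    have hUT : ∀ F : ℕ → ℝ × E × E → ℝ, UnifTight F 1 μR := fun F ε hε =>
      ⟨∅, by simp, fun n => by simp [hzero]⟩
    rw [hzero] at hUT ⊢
    exact ⟨⟨uniformIntegrable_zero_meas, hUT G⟩, ⟨uniformIntegrable_zero_meas, hUT L⟩⟩
  -- positive times almost everywhere, measurability of the two families
  have hae : ∀ᵐ z ∂μR, 0 < z.1 := ae_pos_time_restrict_slab_ball T R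
  have hmeas : ∀ n, AEStronglyMeasurable (G n) μR ∧ AEStronglyMeasurable (L n) μR := by
    intro n
    obtain ⟨hGc, hLc⟩ := (hsol n).measurable_gain_loss_terms_clamp (hker.isDiPernaLionsKernel n).measurable (δ n)
    constructor
    · refine hGc.aestronglyMeasurable.congr (hae.mono fun z hz => ?_)
      simp only [hG, max_eq_left hz.le]
    · refine hLc.aestronglyMeasurable.congr (hae.mono fun z hz => ?_)
      simp only [hL, max_eq_left hz.le]
  -- the velocity convolution dominating the loss term
  set Ch : ℕ → ℝ × E × E → ℝ≥0∞ := fun n z => ∫⁻ w, ENNReal.ofReal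
    (kernelAngularIntegral (Bseq n) (z.2.2 - w) * fseq n (max z.1 0) z.2.1 w) with hCh
  have hLdom : ∀ n, ∀ᵐ z ∂μR, ‖L n z‖ₑ ≤ Ch n z := fun n =>
    hae.mono fun z hz => (hsol n).enorm_loss_term_le (hδ n).le (hker.isDiPernaLionsKernel n) z hz
  obtain ⟨hZI, hZT⟩ := unifIntegrable_unifTight_zero (ι := ℕ) μR
  -- (1) the loss terms are equi-integrable
  have hLUI : UnifIntegrable L 1 μR := by
    refine unifIntegrable_of_dominated_split (g := fun (_ : ℕ) (_ : ℝ × E × E) => (0 : ℝ)) hZI fun ε hε => ?_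
    obtain ⟨Mc, hMc⟩ := exists_conv_dominated_split hB hker hsol hbd hT R hε
    refine ⟨0, Mc, fun n => ?_⟩
    obtain ⟨d, hdm, hdint, hdom⟩ := hMc n
    refine ⟨d, hdm.aemeasurable, hdint, ?_⟩
    filter_upwards [hLdom n] with z hz
    calc ‖L n z‖ₑ ≤ Ch n z := hz
      _ ≤ Mc + d z := hdom z
      _ = _ := by simp
  -- (2) uniform `L¹` bound of the loss terms
  obtain ⟨CL, hCL⟩ := exists_conv_lintegral_le hB hker hsol hbd hT R
  have hLbound : ∀ n, eLpNorm (L n) 1 μR ≤ CL := fun n => by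
    rw [eLpNorm_one_eq_lintegral_enorm]
    exact (lintegral_mono_ae (hLdom n)).trans (hCL n)
  -- (3) the loss terms are uniformly tight
  have hLUT : UnifTight L 1 μR := by
    refine unifTight_of_dominated_split (g := fun (_ : ℕ) (_ : ℝ × E × E) => (0 : ℝ)) hZT fun ε hε => ?_
    obtain ⟨ρ', hρ'⟩ := exists_conv_dominated_off_ball hB hker hsol hbd hT R hε
    refine ⟨0, {z : ℝ × E × E | ‖z.2.1‖ ≤ ρ'}, measurableSet_le measurable_snd.fst.norm measurable_const,
      restrict_slab_ball_measure_xBall_ne_top T R ρ', fun n => ?_⟩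
    obtain ⟨d, hdm, hdint, hdom⟩ := hρ' n
    refine ⟨d, hdm.aemeasurable, hdint, ?_⟩
    filter_upwards [hLdom n] with z hz hzs
    have hx : ρ' < ‖z.2.1‖ := lt_of_not_ge hzs
    calc ‖L n z‖ₑ ≤ Ch n z := hz
      _ ≤ d z := hdom z hx
      _ = _ := by simp
  -- (4) the gain terms: domination by the loss terms and the dissipation majorant
  obtain ⟨Cd, hCd⟩ := hbd.dissipation_le
  set Cd' : ℝ := max Cd 0 with hCd'
  have hCd'0 : 0 ≤ Cd' := le_max_right _ _
  set Dh : ℕ → ℝ × E × E → ℝ≥0∞ := fun n z => ENNReal.ofReal (1 + δ n * ∫ w, |fseq n (max z.1 0) z.2.1 w|)⁻¹ *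
    ∫⁻ q, ENNReal.ofReal (entropyProductionIntegrand (Bseq n) (fseq n (max z.1 0) z.2.1) ((z.2.2, q.1), q.2))
      ∂((volume : Measure E).prod sphereMeasure) with hDh
  have hDhm : ∀ n, Measurable (Dh n) := fun n =>
    (hsol n).measurable_dissipation_majorant (hker.isDiPernaLionsKernel n).measurable
  have hDhint : ∀ n, ∫⁻ z, Dh n z ∂μR ≤ 4 * ENNReal.ofReal Cd' := by
    intro n
    calc ∫⁻ z, Dh n z ∂μR ≤ ∫⁻ z, Dh n z ∂(slabMeasure E T) :=
          lintegral_mono' (restrict_slab_ball_le_slabMeasure T R) le_rfl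
      _ ≤ 4 * ∫⁻ p in Ioi (0 : ℝ) ×ˢ (univ : Set E), eTruncatedEntropyProduction (δ n) (Bseq n) (fseq n p.1 p.2)
            ∂((volume : Measure ℝ).prod volume) :=
          lintegral_slab_dissipation_majorant_le (hsol n) (hker.isDiPernaLionsKernel n).measurable T
      _ ≤ 4 * ENNReal.ofReal Cd' := by
          gcongr
          exact (hCd n).trans (ENNReal.ofReal_le_ofReal (le_max_left _ _))
  have hGdom : ∀ {K : ℝ}, 1 < K → ∀ n, ∀ᵐ z ∂μR,
      ‖G n z‖ₑ ≤ ENNReal.ofReal K * ‖L n z‖ₑ + ENNReal.ofReal (Real.log K)⁻¹ * Dh n z := by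
    intro K hK n
    obtain ⟨Cb, hCb⟩ := hker.bounded n
    filter_upwards [hae] with z hz
    have h := (hsol n).enorm_gain_term_le (hδ n).le (hker.isDiPernaLionsKernel n) hCb hK z hz
    simp only [hDh, max_eq_left hz.le]
    exact h
  -- (5) the gain terms are equi-integrable
  have hGUI : UnifIntegrable G 1 μR := by
    refine unifIntegrable_of_dominated_split (g := L) hLUI fun ε hε => ?_
    set K : ℝ := Real.exp ((4 * Cd' + 1) / ε) with hK
    have hK1 : 1 < K := by
      rw [hK]; exact Real.one_lt_exp_iff.2 (by positivity)
    have hlogK : Real.log K = (4 * Cd' + 1) / ε := Real.log_exp _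
    refine ⟨K.toNNReal, 0, fun n => ⟨fun z => ENNReal.ofReal (Real.log K)⁻¹ * Dh n z,
      ((hDhm n).const_mul _).aemeasurable, ?_, ?_⟩⟩
    · rw [lintegral_const_mul' _ _ ENNReal.ofReal_ne_top]
      calc ENNReal.ofReal (Real.log K)⁻¹ * ∫⁻ z, Dh n z ∂μR
          ≤ ENNReal.ofReal (Real.log K)⁻¹ * (4 * ENNReal.ofReal Cd') := mul_le_mul_of_nonneg_left (hDhint n) bot_le
        _ = ENNReal.ofReal ((Real.log K)⁻¹ * (4 * Cd')) := by
            rw [← ENNReal.ofReal_ofNat 4, ← ENNReal.ofReal_mul (by norm_num),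
              ← ENNReal.ofReal_mul (inv_nonneg.2 (Real.log_nonneg hK1.le))]
        _ ≤ ENNReal.ofReal ε := by
            refine ENNReal.ofReal_le_ofReal ?_
            rw [hlogK, inv_div, div_mul_eq_mul_div, div_le_iff₀ (by positivity)]
            nlinarith
    · filter_upwards [hGdom hK1 n] with z hz
      rw [ENNReal.coe_zero, add_zero]
      exact hz
  -- (6) the gain terms are uniformly tight
  have hGUT : UnifTight G 1 μR := by
    refine unifTight_of_dominated_split (g := L) hLUT fun ε hε => ?_
    set K : ℝ := Real.exp ((4 * Cd' + 1) / ε) with hK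
    have hK1 : 1 < K := by
      rw [hK]; exact Real.one_lt_exp_iff.2 (by positivity)
    have hlogK : Real.log K = (4 * Cd' + 1) / ε := Real.log_exp _
    refine ⟨K.toNNReal, ∅, MeasurableSet.empty, by simp, fun n => ⟨fun z => ENNReal.ofReal (Real.log K)⁻¹ * Dh n z,
      ((hDhm n).const_mul _).aemeasurable, ?_, ?_⟩⟩
    · rw [lintegral_const_mul' _ _ ENNReal.ofReal_ne_top]
      calc ENNReal.ofReal (Real.log K)⁻¹ * ∫⁻ z, Dh n z ∂μR
          ≤ ENNReal.ofReal (Real.log K)⁻¹ * (4 * ENNReal.ofReal Cd') := mul_le_mul_of_nonneg_left (hDhint n) bot_le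
        _ = ENNReal.ofReal ((Real.log K)⁻¹ * (4 * Cd')) := by
            rw [← ENNReal.ofReal_ofNat 4, ← ENNReal.ofReal_mul (by norm_num),
              ← ENNReal.ofReal_mul (inv_nonneg.2 (Real.log_nonneg hK1.le))]
        _ ≤ ENNReal.ofReal ε := by
            refine ENNReal.ofReal_le_ofReal ?_
            rw [hlogK, inv_div, div_mul_eq_mul_div, div_le_iff₀ (by positivity)]
            nlinarith
    · filter_upwards [hGdom hK1 n] with z hz _
      exact hz
  -- (7) uniform `L¹` bound of the gain terms (`K = 2`)
  set DG : ℝ≥0∞ := ENNReal.ofReal 2 * CL + ENNReal.ofReal (Real.log 2)⁻¹ * (4 * ENNReal.ofReal Cd') with hDG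
  have hDGtop : DG ≠ ∞ := ENNReal.add_ne_top.2 ⟨ENNReal.mul_ne_top ENNReal.ofReal_ne_top ENNReal.coe_ne_top,
    ENNReal.mul_ne_top ENNReal.ofReal_ne_top (ENNReal.mul_ne_top (by norm_num) ENNReal.ofReal_ne_top)⟩
  have hGbound : ∀ n, eLpNorm (G n) 1 μR ≤ DG.toNNReal := by
    intro n
    rw [ENNReal.coe_toNNReal hDGtop]
    have h := eLpNorm_one_le_of_dominated (μ := μR) ENNReal.ofReal_ne_top
      (((hDhm n).const_mul (ENNReal.ofReal (Real.log 2)⁻¹)).aemeasurable)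
      (hGdom (by norm_num : (1 : ℝ) < 2) n) (hLbound n) (le_refl _)
    refine h.trans (add_le_add le_rfl ?_)
    rw [lintegral_const_mul' _ _ ENNReal.ofReal_ne_top]
    exact mul_le_mul_of_nonneg_left (hDhint n) bot_le
  exact ⟨⟨⟨fun n => (hmeas n).1, hGUI, DG.toNNReal, hGbound⟩, hGUT⟩,
    ⟨⟨fun n => (hmeas n).2, hLUI, CL, hLbound⟩, hLUT⟩⟩

end Assembly

end Literature.MathematicalPhysics.KineticTheory
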